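import Summits.Ventures.PercRepro.RankLevelSetBiIndepPerCircuit

/-! # RankLevelSetBiIndepBiContainMono — THE CONTAIN-X MONOTONICITY (CX) OF THE BI-INDEPENDENT PROFILE, AND ITS
BRIDGE: (CX) AT THE MIDDLE ON THE MINORS `(M / y) ∖ x` IMPLIES THE PER-CIRCUIT (PC), HENCE (★★) BELOW THE MIDDLE
(night-1 g28; dossier §40.7–40.8)

For a finite matroid `N` and `X ⊆ E(N)` let `α^X_k = biContainCount N X k = #{Z ∈ D_k(N) : X ⊆ Z}` (the bi-independent
`k`-sets containing `X`). **(CX)** (`BiContainMono N`, a `Prop`, NOT asserted): `α^X_k ≤ α^X_{k+1}` whenever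
`2(k+1) ≤ #E` — for `X = ∅` the monotonicity of the bi-independent profile up to the middle (the consequence of the
named Lorentzian fact), for `X = {x}` the monotonicity of the through-`x` profile, in general the mixed profile of the
quotient pair `(N / X, N ∖ X)`. `BiContainMonoMid N` is the single step into the middle (`#E = 2j + 2`:
`α^X_j ≤ α^X_{j+1}`). Census (night-1 g28, own exact code): every matroid with ≤ 8 elements, every independent `X`,
every level up to the middle (147,863 instances at `n = 8`), and 3,176 matroids of 10 … 14 elements (random GF(2)/GF(3)
with relaxations, theta graphs, series extensions; 569,429 instances): 0 failures. THE BRIDGE: for a circuit `C ∋ y`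
of `M` and `x ∈ C ∖ {y}`, a set `P ⊇ C ∖ {y}` avoiding `y` is independent iff `insert y (P ∖ {x})` is
(`indep_iff_insert_sdiff`: the unique circuit of `y` in `P ∪ {y}` is `C`, which contains `x`; conversely
`y ∈ cl(C ∖ {y})`), so `P ↦ P ∖ {x}` identifies the `ℓ(C)`- and `ρ(C)`-families of `RankLevelSetBiIndepPerCircuit`
with the contain-`(C ∖ {y, x})` bi-independent families of the minor `N = (M / y) ∖ x` at the two levels below and at
its middle (`biContainCount_minor_eq`). Hence **`perCircuitMid_of_biContainMonoMid : (∀ N ≤m M, BiContainMonoMid N) →`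
`PerCircuitMid M`**, and with `perElemMid_of_perCircuit`: **`perElemMid_of_biContainMonoMid`** — (★★) at the last level
below the middle for `M` follows from (CX) at the middle on the minors of `M`. Every declaration has a docstring;
imports: the cell's own modules and Mathlib only. Axioms: standard. -/

namespace PercRepro

open Set Matroid

variable {α : Type} (M : Matroid α) [M.Finite]

/-! ## The contain-`X` profile and the Props -/

omit [M.Finite] in
/-- `α^X_k = #{Z ∈ D_k : X ⊆ Z}`: the bi-independent `k`-sets containing `X`. -/
noncomputable def biContainCount (X : Set α) (k : ℕ) : ℕ := {Z ∈ biIndep M k | X ⊆ Z}.ncard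

omit [M.Finite] in
/-- **(CX), the contain-`X` monotonicity** (a `Prop`, NOT asserted): `α^X_k ≤ α^X_{k+1}` for every `X ⊆ E` and every
`k` with `2(k+1) ≤ #E`. -/
def BiContainMono : Prop :=
  ∀ X ⊆ M.E, ∀ k : ℕ, 2 * (k + 1) ≤ M.E.ncard → biContainCount M X k ≤ biContainCount M X (k + 1)

omit [M.Finite] in
/-- **(CX) at the middle** (a `Prop`, NOT asserted): for `#E = 2j + 2`, `α^X_j ≤ α^X_{j+1}` for every `X ⊆ E`. -/
def BiContainMonoMid : Prop :=
  ∀ X ⊆ M.E, ∀ j : ℕ, M.E.ncard = 2 * j + 2 → biContainCount M X j ≤ biContainCount M X (j + 1)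

omit [M.Finite] in
/-- (CX) implies its middle case. -/
lemma biContainMonoMid_of_biContainMono (h : BiContainMono M) : BiContainMonoMid M :=
  fun X hX j hn => h X hX j (by omega)

/-! ## The exchange lemma: for `C ∖ {y} ⊆ P`, `P` is independent iff `insert y (P ∖ {x})` is -/

omit [M.Finite] in
/-- **The key exchange**: let `C` be a circuit through `y`, `x ∈ C ∖ {y}`, and `P ⊇ C ∖ {y}` with `y ∉ P`. Then `P` is
independent iff `insert y (P ∖ {x})` is. (⇒: the unique circuit of `y` in `insert y P` is `C`, which contains `x`;
⇐: `y ∈ cl(C ∖ {y})`, so `x ∈ cl(P ∖ {x})` would force `y ∈ cl(P ∖ {x})`.) -/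
lemma indep_iff_insert_sdiff {y x : α} {C P : Set α} (hC : M.IsCircuit C) (hyC : y ∈ C) (hxC : x ∈ C) (hxy : x ≠ y)
    (hCP : C \ {y} ⊆ P) (hyP : y ∉ P) : M.Indep P ↔ M.Indep (insert y (P \ {x})) := by
  have hxP : x ∈ P := hCP ⟨hxC, hxy⟩
  have hyPx : y ∉ P \ {x} := fun h => hyP h.1
  have hCs : C ⊆ insert y P := by
    intro z hz
    by_cases hzy : z = y
    · exact Or.inl hzy
    · exact Or.inr (hCP ⟨hz, hzy⟩)
  constructor
  · intro hP
    by_contra hdep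
    have hPx : M.Indep (P \ {x}) := hP.subset Set.sdiff_subset
    have hcl : y ∈ M.closure (P \ {x}) := by
      by_contra hcl
      exact hdep ((hPx.insert_indep_iff_of_notMem hyPx).mpr ⟨hC.subset_ground hyC, hcl⟩)
    have hC' := hPx.fundCircuit_isCircuit hcl hyPx
    have hC's : M.fundCircuit y (P \ {x}) ⊆ insert y P :=
      (M.fundCircuit_subset_insert y (P \ {x})).trans (Set.insert_subset_insert Set.sdiff_subset)
    have h1 := hC.eq_fundCircuit_of_subset hP hCs
    have h2 := hC'.eq_fundCircuit_of_subset hP hC's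
    have hx' : x ∈ M.fundCircuit y (P \ {x}) := by rw [h2, ← h1]; exact hxC
    rcases Set.mem_insert_iff.mp (M.fundCircuit_subset_insert y (P \ {x}) hx') with h | h
    · exact hxy h
    · exact h.2 rfl
  · intro hI
    have hPx : M.Indep (P \ {x}) := hI.subset (Set.subset_insert _ _)
    have hxPx : x ∉ P \ {x} := fun h => h.2 rfl
    have hPeq : P = insert x (P \ {x}) := (Set.insert_sdiff_self_of_mem hxP).symm
    rw [hPeq, hPx.insert_indep_iff_of_notMem hxPx]
    refine ⟨hC.subset_ground hxC, fun hxcl => ?_⟩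
    -- `x ∈ cl(P ∖ {x})` forces `C ∖ {y} ⊆ cl(P ∖ {x})`, hence `y ∈ cl(P ∖ {x})`, contradicting `hI`
    have hCcl : C \ {y} ⊆ M.closure (P \ {x}) := by
      intro z hz
      by_cases hzx : z = x
      · exact hzx ▸ hxcl
      · exact M.subset_closure (P \ {x}) (hPx.subset_ground) ⟨hCP hz, hzx⟩
    have hycl : y ∈ M.closure (P \ {x}) :=
      M.closure_subset_closure_of_subset_closure hCcl ((hC.sdiff_singleton_isBasis hyC).subset_closure hyC)
    exact (hPx.insert_dep_iff.mpr ⟨hycl, hyPx⟩).not_indep hI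

/-! ## The contain-`X` families of the minor `(M / y) ∖ x` are the per-circuit families -/

omit [M.Finite] in
/-- Independence in the minor `(M / y) ∖ x` for a non-loop `y`. -/
lemma minor_indep_iff' {y x : α} (hy : M.Indep {y}) (T : Set α) :
    ((M ／ {y}) ＼ {x}).Indep T ↔ (Disjoint T {y} ∧ M.Indep (T ∪ {y})) ∧ Disjoint T {x} := by
  rw [delete_indep_iff, hy.contract_indep_iff]

omit [M.Finite] in
/-- The ground set of the minor `(M / y) ∖ x`. -/
lemma minor_ground_eq' (y x : α) : ((M ／ {y}) ＼ {x}).E = (M.E \ {y}) \ {x} := by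
  rw [delete_ground, contract_ground]

/-- **The contain-`(C ∖ {y, x})` bi-independent `k`-sets of `(M / y) ∖ x` correspond to the `(k+1)`-sets `P ⊇ C ∖ {y}`
of the per-circuit families** (by `P ↦ P ∖ {x}`). -/
lemma biContainCount_minor_eq {y x : α} {C : Set α} (hC : M.IsCircuit C) (hyC : y ∈ C) (hxC : x ∈ C) (hxy : x ≠ y)
    (hy : M.Indep {y}) (k : ℕ) :
    biContainCount ((M ／ {y}) ＼ {x}) ((C \ {y}) \ {x}) k =
      {P : Set α | P ⊆ M.E \ {y} ∧ P.ncard = k + 1 ∧ C \ {y} ⊆ P ∧ M.Indep P ∧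
        M.Indep (insert y ((M.E \ {y}) \ P))}.ncard := by
  have hxE : x ∈ M.E := hC.subset_ground hxC
  have hyE : y ∈ M.E := hC.subset_ground hyC
  unfold biContainCount biIndep
  simp only [minor_ground_eq', minor_indep_iff' M hy]
  symm
  refine Set.ncard_congr (fun P _ => P \ {x}) ?_ ?_ ?_
  · rintro P ⟨hPE, hPcard, hCP, hPind, hPcind⟩
    have hyP : y ∉ P := fun h => (hPE h).2 rfl
    have hxP : x ∈ P := hCP ⟨hxC, hxy⟩
    have hPfin : P.Finite := M.ground_finite.subset (hPE.trans Set.sdiff_subset)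
    have hcompl : ((M.E \ {y}) \ {x}) \ (P \ {x}) = (M.E \ {y}) \ P := by
      ext z
      simp only [Set.mem_sdiff, Set.mem_singleton_iff]
      constructor
      · rintro ⟨⟨hz, hzx⟩, hzP⟩
        exact ⟨hz, fun hzP' => hzP ⟨hzP', hzx⟩⟩
      · rintro ⟨hz, hzP⟩
        exact ⟨⟨hz, fun hzx => hzP (hzx ▸ hxP)⟩, fun h => hzP h.1⟩
    refine ⟨⟨Set.sdiff_subset_sdiff_left hPE, ?_, ⟨⟨?_, ?_⟩, Set.disjoint_sdiff_left⟩, ?_⟩, ?_⟩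
    · rw [Set.ncard_sdiff_singleton_of_mem hxP, hPcard]; rfl
    · exact Set.disjoint_singleton_right.mpr (fun h => hyP h.1)
    · rw [Set.union_singleton]
      exact (indep_iff_insert_sdiff M hC hyC hxC hxy hCP hyP).mp hPind
    · rw [hcompl]
      refine ⟨⟨Set.disjoint_singleton_right.mpr (fun h => h.1.2 rfl), ?_⟩,
        Set.disjoint_singleton_right.mpr (fun h => h.2 hxP)⟩
      rw [Set.union_singleton]; exact hPcind
    · intro z hz
      exact ⟨hCP hz.1, hz.2⟩
  · rintro P P' ⟨-, -, hCP, -, -⟩ ⟨-, -, hCP', -, -⟩ h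
    have hxP : x ∈ P := hCP ⟨hxC, hxy⟩
    have hxP' : x ∈ P' := hCP' ⟨hxC, hxy⟩
    rw [← Set.insert_sdiff_self_of_mem hxP, ← Set.insert_sdiff_self_of_mem hxP', h]
  · rintro Z ⟨⟨hZE, hZcard, ⟨⟨hZy, hZind⟩, hZx⟩, ⟨⟨-, hZcind⟩, -⟩⟩, hXZ⟩
    have hxZ : x ∉ Z := fun h => (hZE h).2 rfl
    have hyZ : y ∉ Z := fun h => (hZE h).1.2 rfl
    have hZfin : Z.Finite := M.ground_finite.subset (hZE.trans (Set.sdiff_subset.trans Set.sdiff_subset))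
    have hCP : C \ {y} ⊆ insert x Z := by
      intro z hz
      by_cases hzx : z = x
      · exact Or.inl hzx
      · exact Or.inr (hXZ ⟨hz, hzx⟩)
    have hyP : y ∉ insert x Z := by
      rintro (h | h)
      · exact hxy h.symm
      · exact hyZ h
    have hcompl : ((M.E \ {y}) \ {x}) \ Z = (M.E \ {y}) \ insert x Z := by
      ext z
      simp only [Set.mem_sdiff, Set.mem_singleton_iff, Set.mem_insert_iff]
      tauto
    refine ⟨insert x Z, ⟨?_, ?_, hCP, ?_, ?_⟩, Set.insert_sdiff_self_of_notMem hxZ⟩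
    · exact Set.insert_subset ⟨hxE, fun h => hxy (Set.mem_singleton_iff.mp h)⟩ (hZE.trans Set.sdiff_subset)
    · rw [Set.ncard_insert_of_notMem hxZ hZfin, hZcard]
    · rw [indep_iff_insert_sdiff M hC hyC hxC hxy hCP hyP, Set.insert_sdiff_self_of_notMem hxZ,
        ← Set.union_singleton]
      exact hZind
    · rw [← hcompl, ← Set.union_singleton]; exact hZcind

/-! ## The bridge -/

/-- If `y` is a loop, the per-circuit families are empty (their complements through `y` cannot be independent). -/
lemma circuitLowCount_eq_zero_of_loop {y : α} (hy : ¬ M.Indep {y}) (C : Set α) (j : ℕ) :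
    circuitLowCount M y C j = 0 := by
  unfold circuitLowCount
  rw [Set.ncard_eq_zero (M.ground_finite.finite_subsets.subset (fun P hP => hP.1.trans Set.sdiff_subset))]
  ext P
  simp only [Set.mem_setOf_eq, Set.mem_empty_iff_false, iff_false, not_and]
  intro _ _ _ _ hind
  exact hy (hind.subset (Set.singleton_subset_iff.mpr (Set.mem_insert y _)))

/-- **(CX) AT THE MIDDLE ON THE MINORS IMPLIES THE PER-CIRCUIT (PC)**: if every minor of `M` satisfies
`BiContainMonoMid`, then `M` satisfies `PerCircuitMid`. -/
theorem perCircuitMid_of_biContainMonoMid (h : ∀ N : Matroid α, N ≤m M → BiContainMonoMid N) : PerCircuitMid M := by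
  intro y hyE C hC hyC j hn
  by_cases hy : M.Indep {y}
  · -- `y` is not a loop: `C` has a second element `x`
    have hne : (C \ {y}).Nonempty := by
      by_contra hempty
      rw [Set.not_nonempty_iff_eq_empty, Set.sdiff_eq_empty] at hempty
      exact hC.dep.not_indep (hy.subset hempty)
    obtain ⟨x, hxC, hxy'⟩ := hne
    have hxy : x ≠ y := fun h => hxy' (Set.mem_singleton_iff.mpr h)
    have hxE : x ∈ M.E := hC.subset_ground hxC
    -- the minor `N = (M / y) ∖ x` has `2j` elements
    have hNmin : (M ／ {y}) ＼ {x} ≤m M := ⟨{y}, {x}, rfl⟩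
    have hxE' : x ∈ M.E \ {y} := ⟨hxE, fun h => hxy (Set.mem_singleton_iff.mp h)⟩
    have hNfin : ((M ／ {y}) ＼ {x}).E.ncard = 2 * j := by
      rw [minor_ground_eq', Set.ncard_sdiff_singleton_of_mem hxE', Set.ncard_sdiff_singleton_of_mem hyE, hn]
      omega
    rcases j with _ | j'
    · -- `j = 0`: no `0`-set contains the nonempty `C ∖ {y}`
      have hzero : circuitLowCount M y C 0 = 0 := by
        unfold circuitLowCount
        rw [Set.ncard_eq_zero (M.ground_finite.finite_subsets.subset (fun P hP => hP.1.trans Set.sdiff_subset))]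
        ext P
        simp only [Set.mem_setOf_eq, Set.mem_empty_iff_false, iff_false, not_and]
        intro hPE hP0 hCP _ _
        have hPfin : P.Finite := M.ground_finite.subset (hPE.trans Set.sdiff_subset)
        rw [Set.ncard_eq_zero hPfin] at hP0
        rw [hP0] at hCP
        exact hCP ⟨hxC, hxy'⟩
      rw [hzero]
      exact Nat.zero_le _
    · have hstep := h _ hNmin ((C \ {y}) \ {x}) ?_ j' (by rw [hNfin]; ring)
      · rw [biContainCount_minor_eq M hC hyC hxC hxy hy j', biContainCount_minor_eq M hC hyC hxC hxy hy (j' + 1)] at hstep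
        exact hstep
      · rw [minor_ground_eq']
        intro z hz
        exact ⟨⟨hC.subset_ground hz.1.1, hz.1.2⟩, hz.2⟩
  · rw [circuitLowCount_eq_zero_of_loop M hy C j]
    exact Nat.zero_le _

/-- **(CX) AT THE MIDDLE ON THE MINORS IMPLIES (★★) AT THE LAST LEVEL BELOW THE MIDDLE**: for `#E = 2j + 2` and `y ∈ E`,
`#{Z ∈ D_j : y ∉ Z} ≤ #{Q ∈ D_{j+1} : y ∈ Q}`. -/
theorem perElemMid_of_biContainMonoMid (h : ∀ N : Matroid α, N ≤m M → BiContainMonoMid N) {y : α} (hyE : y ∈ M.E)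
    {j : ℕ} (hn : M.E.ncard = 2 * j + 2) :
    {Z ∈ biIndep M j | y ∉ Z}.ncard ≤ {Q ∈ biIndep M (j + 1) | y ∈ Q}.ncard :=
  perElemMid_of_perCircuit M (perCircuitMid_of_biContainMonoMid M h) hyE hn

end PercRepro
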